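import Literature.NumberTheory.Sieve.SieveAdjoint
import HarnessLib

/-!
# Raising the parameter `a` of an adjoint solution by integration (Greaves (3.18))

Trunk `AntSieve` (topic `NumberTheory/Sieve`). [Greaves2001, §4.2.3 (3.18)]: the standard
solutions of the adjoint equations `(s r(s))' = a r(s) + b r(s + 1)` satisfy
`c_{a,b} r'_{a,b} = r_{a−1,b}`. Conversely — the observation formalised here — if `r₁` solves the
`(a − 1, b)`-equation on `(0, ∞)`, then for EVERY antiderivative `R` of `c₀ r₁` the quantity
`(s R(s))' − a R(s) − b R(s + 1)` is constant, and adding a constant `D` to `R` changes it by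
`(1 − a − b) D`; so for `a + b ≠ 1` a unique shift of `R` solves the `(a, b)`-equation
(`exists_hasDerivAt_mul_of_step`). Together with the Laplace-transform solutions for
`a + b < 1` (`SieveAdjointLaplace`) and the constant solution `r ≡ 1` for `a + b = 1`, this
constructs solutions of the adjoint equation for all `(a, b)`, in particular Iwaniec's
`q_κ = r_{κ,κ}`, by finitely many integrations. This file also records the passage between the
two forms of the adjoint equation: `(s r)' = a r + b r(s + 1)` and
`(s^{1−a} r)' = b s^{−a} r(s + 1)` (`IsSieveAdjoint`, [Greaves2001, (2.2), (2.10)]).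

## References

* [Greaves2001] G. Greaves, *Sieves in Number Theory*, Springer (2001), §4.2.2 (2.2), (2.10);
  §4.2.3 (3.18) and the remark "the solution `s − b` if `a + b = 2`", "`r(s) = 1` if `a + b = 1`".
-/

open Filter Set Topology MeasureTheory

noncomputable section

namespace Literature.NumberTheory.Sieve

/-! ### The two forms of the adjoint equation -/

/-- From `(s r(s))' = a r(s) + b r(s + 1)` on `(0, ∞)` to `IsSieveAdjoint a b r`
(`(s^{1−a} r)' = b s^{−a} r(s + 1)`) [Greaves2001, (2.2) ⇒ (2.10)].
[cite: Greaves2001, §4.2.2 (2.10)] -/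
theorem isSieveAdjoint_of_hasDerivAt_mul {a b : ℝ} {r : ℝ → ℝ}
    (h : ∀ s : ℝ, 0 < s → HasDerivAt (fun t : ℝ => t * r t) (a * r s + b * r (s + 1)) s) :
    IsSieveAdjoint a b r := by
  intro s hs
  have h1 : HasDerivAt (fun t : ℝ => t ^ (-a)) (-a * s ^ (-a - 1)) s :=
    Real.hasDerivAt_rpow_const (Or.inl hs.ne')
  have h2 := h1.mul (h s hs)
  have heq : (fun t : ℝ => t ^ (1 - a) * r t) =ᶠ[𝓝 s] fun t => t ^ (-a) * (t * r t) := by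
    filter_upwards [Ioi_mem_nhds hs] with t (ht : 0 < t)
    rw [← mul_assoc, sub_eq_add_neg, Real.rpow_add ht, Real.rpow_one, mul_comm (t : ℝ)]
  refine (h2.congr_of_eventuallyEq heq).congr_deriv ?_
  have hs1 : s ^ (-a - 1) * s = s ^ (-a) := by
    rw [sub_eq_add_neg, Real.rpow_add hs, Real.rpow_neg_one, mul_assoc, inv_mul_cancel₀ hs.ne',
      mul_one]
  calc -a * s ^ (-a - 1) * (s * r s) + s ^ (-a) * (a * r s + b * r (s + 1))
      = -a * (s ^ (-a - 1) * s) * r s + s ^ (-a) * (a * r s + b * r (s + 1)) := by ring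
    _ = b * s ^ (-a) * r (s + 1) := by rw [hs1]; ring

/-- From `IsSieveAdjoint a b r` to `(s r(s))' = a r(s) + b r(s + 1)` on `(0, ∞)`
[Greaves2001, (2.10) ⇒ (2.2)]. [cite: Greaves2001, §4.2.2 (2.2)] -/
theorem IsSieveAdjoint.hasDerivAt_mul {a b : ℝ} {r : ℝ → ℝ} (h : IsSieveAdjoint a b r) {s : ℝ}
    (hs : 0 < s) : HasDerivAt (fun t : ℝ => t * r t) (a * r s + b * r (s + 1)) s := by
  have h1 : HasDerivAt (fun t : ℝ => t ^ a) (a * s ^ (a - 1)) s :=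
    Real.hasDerivAt_rpow_const (Or.inl hs.ne')
  have h2 := h1.mul (h s hs)
  have heq : (fun t : ℝ => t * r t) =ᶠ[𝓝 s] fun t => t ^ a * (t ^ (1 - a) * r t) := by
    filter_upwards [Ioi_mem_nhds hs] with t (ht : 0 < t)
    rw [← mul_assoc, ← Real.rpow_add ht, show a + (1 - a) = 1 by ring, Real.rpow_one]
  refine (h2.congr_of_eventuallyEq heq).congr_deriv ?_
  have e1 : s ^ (a - 1) * s ^ (1 - a) = 1 := by
    rw [← Real.rpow_add hs]; norm_num
  have e2 : s ^ a * s ^ (-a) = 1 := by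
    rw [← Real.rpow_add hs]; norm_num
  linear_combination (a * r s) * e1 + (b * r (s + 1)) * e2

/-- A solution of `(s r)' = a r + b r(s + 1)` on `(0, ∞)` is continuous there. [folklore] -/
theorem continuousOn_of_hasDerivAt_mul {a b : ℝ} {r : ℝ → ℝ}
    (h : ∀ s : ℝ, 0 < s → HasDerivAt (fun t : ℝ => t * r t) (a * r s + b * r (s + 1)) s) :
    ContinuousOn r (Ioi 0) :=
  (isSieveAdjoint_of_hasDerivAt_mul h).continuousOn

/-! ### The integration step -/

/-- **The integration step** (converse of [Greaves2001, (3.18)]). Let `r₁` solve the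
`(a − 1, b)`-equation `(s r₁)' = (a − 1) r₁(s) + b r₁(s + 1)` on `(0, ∞)` and let `a + b ≠ 1`.
Then for every `c₀` there is `R` on `(0, ∞)` with `R' = c₀ r₁` solving the `(a, b)`-equation
`(s R)' = a R(s) + b R(s + 1)`: take `R = c₀ ∫_1^s r₁ + D`; the expression
`(1 − a) R + c₀ s r₁ − b R(s + 1) = (s R)' − a R − b R(s + 1)` has zero derivative, hence is a
constant `K + (1 − a − b) D`, which vanishes for the right `D`.
[cite: Greaves2001, §4.2.3 (3.18)] -/
theorem exists_hasDerivAt_mul_of_step {a b : ℝ} (hab : a + b ≠ 1) {r₁ : ℝ → ℝ}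
    (h₁ : ∀ s : ℝ, 0 < s → HasDerivAt (fun t : ℝ => t * r₁ t) ((a - 1) * r₁ s + b * r₁ (s + 1)) s)
    (c₀ : ℝ) :
    ∃ R : ℝ → ℝ, (∀ s : ℝ, 0 < s → HasDerivAt R (c₀ * r₁ s) s) ∧
      ∀ s : ℝ, 0 < s → HasDerivAt (fun t : ℝ => t * R t) (a * R s + b * R (s + 1)) s := by
  have hc : ContinuousOn r₁ (Ioi 0) := continuousOn_of_hasDerivAt_mul h₁
  -- the primitive `P s = ∫_1^s r₁`
  set P : ℝ → ℝ := fun s => ∫ t in (1 : ℝ)..s, r₁ t with hP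
  have hPd : ∀ s : ℝ, 0 < s → HasDerivAt P (r₁ s) s := by
    intro s hs
    refine intervalIntegral.integral_hasDerivAt_right ?_
      (hc.stronglyMeasurableAtFilter isOpen_Ioi s hs) (hc.continuousAt (Ioi_mem_nhds hs))
    refine (hc.mono fun t ht => ?_).intervalIntegrable
    exact lt_of_lt_of_le (lt_min one_pos hs) ht.1
  -- `R₀ = c₀ P` and the invariant `Φ`
  set R₀ : ℝ → ℝ := fun s => c₀ * P s with hR₀
  have hR₀d : ∀ s : ℝ, 0 < s → HasDerivAt R₀ (c₀ * r₁ s) s := fun s hs => (hPd s hs).const_mul c₀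
  set Φ : ℝ → ℝ := fun s => (1 - a) * R₀ s + c₀ * (s * r₁ s) - b * R₀ (s + 1) with hΦ
  have hΦd : ∀ s : ℝ, 0 < s → HasDerivAt Φ 0 s := by
    intro s hs
    have h1 := ((hR₀d s hs).const_mul (1 - a)).add ((h₁ s hs).const_mul c₀)
    have h2 : HasDerivAt (fun t => R₀ (t + 1)) (c₀ * r₁ (s + 1)) s := by
      have := (hR₀d (s + 1) (by linarith)).comp_add_const s 1
      simpa using this
    refine ((h1.sub (h2.const_mul b))).congr_deriv ?_
    ring
  have hΦconst : ∀ s : ℝ, 0 < s → Φ s = Φ 1 := fun s hs =>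
    isOpen_Ioi.is_const_of_deriv_eq_zero isPreconnected_Ioi
      (fun y (hy : 0 < y) => (hΦd y hy).differentiableAt.differentiableWithinAt)
      (fun y (hy : 0 < y) => (hΦd y hy).deriv) (show s ∈ Ioi 0 from hs)
      (show (1 : ℝ) ∈ Ioi 0 from show (0 : ℝ) < 1 from one_pos)
  -- the shift
  set K : ℝ := Φ 1 with hK
  have h1ab : (1 - a - b) ≠ 0 := fun h => hab (by linarith)
  set D : ℝ := -K / (1 - a - b) with hD
  refine ⟨fun s => R₀ s + D, fun s hs => by simpa using (hR₀d s hs).add_const D, fun s hs => ?_⟩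
  have hinv : (1 - a) * (R₀ s + D) + c₀ * (s * r₁ s) - b * (R₀ (s + 1) + D) = 0 := by
    have h1 : (1 - a) * (R₀ s + D) + c₀ * (s * r₁ s) - b * (R₀ (s + 1) + D) =
        Φ s + (1 - a - b) * D := by simp only [hΦ]; ring
    rw [h1, hΦconst s hs]
    show K + (1 - a - b) * (-K / (1 - a - b)) = 0
    field_simp
    ring
  have h2 := (hasDerivAt_id s).mul ((hR₀d s hs).add_const D)
  refine h2.congr_deriv ?_
  simp only [id, one_mul]
  linear_combination hinv

/-- **The constant solution for `a + b = 1`**: `r ≡ 1` solves `(s r)' = a r + b r(s + 1)`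
[Greaves2001, §4.2.3: "`r(s) = 1` if `a + b = 1`"]. [cite: Greaves2001, §4.2.3 before (3.1)] -/
theorem hasDerivAt_mul_one_of_add_eq_one {a b : ℝ} (hab : a + b = 1) (s : ℝ) :
    HasDerivAt (fun t : ℝ => t * (fun _ : ℝ => (1 : ℝ)) t) (a * 1 + b * 1) s := by
  have h := (hasDerivAt_id s)
  have h' : HasDerivAt (fun t : ℝ => t) 1 s := h
  refine (h'.congr_of_eventuallyEq (Eventually.of_forall fun t => ?_)).congr_deriv ?_
  · simp
  · linarith

end Literature.NumberTheory.Sieve
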